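import Literature.Computability.Complexity.TVMatrixBricks
import Literature.Computability.Complexity.DownwardChainChecker
import HarnessLib

/-!
# `FP` bricks for the downward checker of Trevisan–Vadhan's language, I: Lagrange evaluation of the
# oracle's answers

Literature / complexity — the first MACHINE layer of the downward checker whose analysis is
`DownwardChainChecker.lean` / `TVDownwardCheckerAnalysis.lean` (Murray–Williams' Thm. 2.2 = SIAM
Thm. 2.7 after Santhanam 2009, Lemma 12; Lund–Fortnow–Karloff–Nisan's verifier against a
function-restricted prover). At every stage the verifier reads the oracle's `δ + 1` values of the
next level on the axis line at the nodes `a₀, …, a_δ` and needs the interpolant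
`q = ChainCheck.interp` at `0`, `1` and at the random challenge: Lagrange's formula
`q(t) = Σ_l y_l ∏_{u ≠ l} (a_l - a_u)⁻¹ (t - a_u)` in the field `GF(2^{M+1})` of `M + 1`-bit strings
(`GF2Str.bits`, `GF2StringArith.lean`), with the nodes `a_u =` the field element whose coordinates are
the binary digits of `u` (`GF2Str.cubeStrN M (M+1) u = natBits (M+1) u`; in `TVDownwardCheckerAnalysis`
these are `QBFUniv.node`). In the brick algebra of `HardLangMachine.lean` (`xorF`, `fmulOpF`, `finvF`;
counted folds `Brick.foldLoop`), uniform in `M` (the modulus `f = modStr M` travels in the record):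

* string level: `TVChk.nodeVal`, `TVChk.basisFactorVal` / `basisStrs` (`basisStrs_bits`), `TVChk.sumStr`
  (`sumStr_bits`), `TVChk.lagVal` with **`TVChk.lagVal_eq_eval_interp`** (the formula IS the evaluation
  of `ChainCheck.interp` at distinct nodes, `Lagrange.interpolate_apply`);
* `TVChk.basisF` on the context `⟨⟨1ˡ, t⟩, ⟨1ᴰ, f⟩⟩` — the basis polynomial `∏_{u<D, u≠l} (a_l-a_u)⁻¹(t-a_u)`
  as a product fold (`basisF_mem_FP`, **`basisF_apply`**);
* `TVChk.lagF` on `⟨⟨t, Y⟩, ⟨1ᴰ, f⟩⟩`, `Y` the `D` answer blocks of `M + 1` bits — the xor fold of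
  `y_l · basis_l(t)` (`lagF_mem_FP`, **`lagF_apply`**: the bits of `lagVal`, i.e. of `q(t)`).

Everything is proved; definitions are `FP` string functions (no named facts, D-0026). The stage, run
and repetition bricks and the parsing wrapper are the next files.

## References

* C. Lund, L. Fortnow, H. Karloff, N. Nisan, *Algebraic methods for interactive proof systems*,
  J. ACM 39 (1992), §3 (the verifier evaluates the prover's polynomial) [LundEtAl1992].
* S. Arora, B. Barak, *Computational Complexity: A Modern Approach*, CUP 2009, §8.3.2–8.3.3, §A.6
  (Lagrange interpolation), §1.3 (composition of polynomial-time computations) [AroraBarakCC2009].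
* L. Trevisan, S. Vadhan, Comput. Complexity 16 (2007), Thm. 4.3, Thm. 5.4 [TrevisanVadhan2007].
-/

noncomputable section

namespace Literature.Computability.Complexity

namespace TVChk

open _root_.Computability Polynomial Finset Brick Plumb GF2Str HardLangM TVBrick QBFUniv SelfCorrect
  Literature.InformationTheory.Coding

variable (M : ℕ)

/-! ### String level: nodes, basis factors, sums -/

/-- **Node `u`**: the field element whose power-basis coordinates are the binary digits of `u`
(`cubePt` with all `M + 1` coordinates). [folklore] -/
def nodeVal (u : ℕ) : GF2 M := cubePt (M + 1) M (bitsOf (M + 1) u)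

/-- The node's bits are the binary digits: `natBits (M+1) u = bits M (nodeVal M u)`. [folklore] -/
theorem natBits_eq_bits_nodeVal (u : ℕ) : natBits (M + 1) u = bits M (nodeVal M u) := by
  have h := cubeStrN_eq M (M + 1) le_rfl u
  rwa [cubeStrN, Nat.sub_self, List.replicate_zero, List.append_nil] at h

/-- Distinct small numbers are distinct nodes. [folklore] -/
theorem nodeVal_injOn {u v : ℕ} (hu : u < 2 ^ (M + 1)) (hv : v < 2 ^ (M + 1)) (h : nodeVal M u = nodeVal M v) : u = v := by
  have h' : natBits (M + 1) u = natBits (M + 1) v := by rw [natBits_eq_bits_nodeVal, natBits_eq_bits_nodeVal, h]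
  have := congrArg bitsToNat h'
  rwa [bitsToNat_natBits hu, bitsToNat_natBits hv] at this

/-- **The basis factor** of node `l` against node `u` at `t`: `1` for `u = l`, else
`(a_l - a_u)⁻¹ (t - a_u)`. [cite: AroraBarakCC2009, §A.6 (Lagrange interpolation)] -/
def basisFactorVal (l u : ℕ) (t : GF2 M) : GF2 M :=
  if u = l then 1 else (nodeVal M l - nodeVal M u)⁻¹ * (t - nodeVal M u)

/-- The basis factors on strings (`deltaFactor` of `GF2StringArith` at full width). [folklore] -/
def basisStrs (l : ℕ) (t : List Bool) (u : ℕ) : List Bool :=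
  if u = l then bits M 1 else deltaFactor M (M + 1) l u t

/-- **The string factors spell the field factors** (`M ≥ 1`). [folklore] -/
theorem basisStrs_bits (hM : 1 ≤ M) (l : ℕ) (t : GF2 M) (u : ℕ) :
    basisStrs M l (bits M t) u = bits M (basisFactorVal M l u t) := by
  rw [basisStrs, basisFactorVal]
  split_ifs with h
  · rfl
  · rw [deltaFactor, cubeStrN_eq M (M + 1) le_rfl, cubeStrN_eq M (M + 1) le_rfl, xorStr_bits, xorStr_bits,
      finvStr_bits M hM, fmulStr_bits, sub_eq_add', sub_eq_add']
    unfold nodeVal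
    rfl

/-- **The xor (sum) fold** on strings. [folklore] -/
def sumStr (g : ℕ → List Bool) (n : ℕ) : List Bool := (List.range n).foldl (fun acc k => xorStr acc (g k)) (bits M 0)

/-- Value of the sum fold on bits. [folklore] -/
theorem sumStr_bits (G : ℕ → GF2 M) (n : ℕ) : sumStr M (fun k => bits M (G k)) n = bits M (∑ k ∈ range n, G k) := by
  induction n with
  | zero => simp [sumStr]
  | succ n ih =>
    rw [sumStr, List.range_succ, List.foldl_append, List.foldl_cons, List.foldl_nil, ← sumStr, ih, xorStr_bits,
      sum_range_succ]

/-- Length of a sum fold string: `M + 1`, if all summands have that length. [folklore] -/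
theorem length_sumStr {g : ℕ → List Bool} (hg : ∀ k, (g k).length = M + 1) : ∀ n, (sumStr M g n).length = M + 1
  | 0 => by simp [sumStr]
  | n + 1 => by
    rw [sumStr, List.range_succ, List.foldl_append, List.foldl_cons, List.foldl_nil, ← sumStr, length_xorStr,
      length_sumStr hg n, hg, max_self]

/-- **Lagrange's formula**: `Σ_{l<D} y_l ∏_{u<D} basisFactor_{l,u}(t)`. [cite: AroraBarakCC2009, §A.6] -/
def lagVal (D : ℕ) (y : ℕ → GF2 M) (t : GF2 M) : GF2 M := ∑ l ∈ range D, y l * ∏ u ∈ range D, basisFactorVal M l u t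

/-- **Lagrange's formula evaluates the interpolant** through distinct nodes (`ChainCheck.interp`,
Mathlib's `Lagrange.interpolate`). [cite: AroraBarakCC2009, §A.6 (Lagrange interpolation)] -/
theorem lagVal_eq_eval_interp {δ : ℕ} (w : Fin (δ + 1) → GF2 M) (y : ℕ → GF2 M)
    (hy : ∀ l : Fin (δ + 1), y l.val = w l) (t : GF2 M) :
    lagVal M (δ + 1) y t = (ChainCheck.interp (fun l : Fin (δ + 1) => nodeVal M l.val) w).eval t := by
  classical
  rw [ChainCheck.interp, Lagrange.interpolate_apply, eval_finsetSum, lagVal, ← Fin.sum_univ_eq_sum_range]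
  refine sum_congr rfl fun l _ => ?_
  rw [eval_mul, eval_C, hy l]
  congr 1
  -- the basis polynomial, evaluated, is the product of the factors over the other nodes
  have hb : (Lagrange.basis univ (fun l : Fin (δ + 1) => nodeVal M l.val) l).eval t =
      ∏ u ∈ univ.erase l, (nodeVal M l.val - nodeVal M u.val)⁻¹ * (t - nodeVal M u.val) := by
    unfold Lagrange.basis
    rw [eval_prod]
    refine prod_congr rfl fun u _ => ?_
    simp [Lagrange.basisDivisor]
  rw [hb, ← Fin.prod_univ_eq_prod_range (fun u => basisFactorVal M l.val u t), ← Finset.mul_prod_erase _ _ (mem_univ l)]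
  rw [basisFactorVal, if_pos rfl, one_mul]
  refine prod_congr rfl fun u hu => ?_
  have hne : u.val ≠ l.val := fun h => (mem_erase.1 hu).1 (Fin.ext h)
  rw [basisFactorVal, if_neg hne]

/-! ### The basis brick: `∏_{u<D} basisFactor_{l,u}(t)` on `⟨⟨1ˡ, t⟩, ⟨1ᴰ, f⟩⟩` -/

/-- The basis context `⟨⟨1ˡ, t⟩, ⟨1ᴰ, f⟩⟩`. [folklore] -/
def bCtx (l : ℕ) (t : List Bool) (D : ℕ) (f : List Bool) : List Bool :=
  boolPair (boolPair (ones l) t) (boolPair (ones D) f)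

/-- `1ˡ` of the piece argument `⟨bCtx, 1ᵘ⟩`. [folklore] -/
def iL : List Bool → List Bool := fstF ∘ fstF ∘ fstF
/-- `t` of `⟨bCtx, 1ᵘ⟩`. [folklore] -/
def iT : List Bool → List Bool := sndF ∘ fstF ∘ fstF
/-- `f` of `⟨bCtx, 1ᵘ⟩`. [folklore] -/
def iF : List Bool → List Bool := sndF ∘ sndF ∘ fstF
/-- `1ᵘ` of `⟨bCtx, 1ᵘ⟩`. [folklore] -/
def iU : List Bool → List Bool := sndF

/-- The accessors are in `FP`. [folklore] -/
theorem iAcc_mem_FP : iL ∈ FP ∧ iT ∈ FP ∧ iF ∈ FP ∧ iU ∈ FP :=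
  ⟨comp_mem_FP fstF_mem_FP (comp_mem_FP fstF_mem_FP fstF_mem_FP),
   comp_mem_FP sndF_mem_FP (comp_mem_FP fstF_mem_FP fstF_mem_FP),
   comp_mem_FP sndF_mem_FP (comp_mem_FP sndF_mem_FP fstF_mem_FP), sndF_mem_FP⟩

/-- Values of the accessors. [folklore] -/
theorem iAcc_apply (l : ℕ) (t : List Bool) (D : ℕ) (f : List Bool) (u : ℕ) :
    iL (boolPair (bCtx l t D f) (ones u)) = ones l ∧ iT (boolPair (bCtx l t D f) (ones u)) = t ∧
    iF (boolPair (bCtx l t D f) (ones u)) = f ∧ iU (boolPair (bCtx l t D f) (ones u)) = ones u := by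
  simp [iL, iT, iF, iU, bCtx]

/-- **The string of node `|G z|`** at full width: `natBits (M+1) |G z|`, the width `M + 1` read off the
modulus returned by `F` (`|f| = M + 2`). [folklore] -/
def nodeOf (G F : List Bool → List Bool) : List Bool → List Bool :=
  fstF ∘ padTakeFn ∘ fanoutFn (dropFn ∘ fanoutFn (fun _ => [true]) F) (lenBinF ∘ G)

/-- `nodeOf G F ∈ FP`. [folklore] -/
theorem nodeOf_mem_FP {G F : List Bool → List Bool} (hG : G ∈ FP) (hF : F ∈ FP) : nodeOf G F ∈ FP :=
  comp_mem_FP fstF_mem_FP (comp_mem_FP padTakeFn_mem_FP (fanoutFn_mem_FP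
    (comp_mem_FP dropFn_mem_FP (fanoutFn_mem_FP (const_mem_FP _) hF)) (comp_mem_FP lenBinF_mem_FP hG)))

/-- **Value of `nodeOf`**: the bits of node `|G z|` (`|G z| < 2^{M+1}`, `F z = modStr M`). [folklore] -/
theorem nodeOf_apply {G F : List Bool → List Bool} {z : List Bool} (hF : F z = modStr M) {u : ℕ}
    (hG : (G z).length = u) (hu : u < 2 ^ (M + 1)) : nodeOf G F z = bits M (nodeVal M u) := by
  simp only [nodeOf, Function.comp_apply, fanoutFn_apply, hF, dropFn_boolPair, List.length_singleton, lenBinF_apply, hG,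
    padTakeFn_boolPair, fstF_boolPair, List.length_drop, (modStr_top M).1]
  rw [show M + 1 + 1 - 1 = M + 1 by omega, PRGDerand.takeD_encodeNat_eq_natBits hu, natBits_eq_bits_nodeVal]

/-- **The factor brick** `(a_l - a_u)⁻¹ (t - a_u)` on `⟨bCtx, 1ᵘ⟩`. [cite: AroraBarakCC2009, §A.6] -/
def factorF : List Bool → List Bool :=
  fmulOpF ∘ fanoutFn (finvF ∘ fanoutFn (xorF ∘ fanoutFn (nodeOf iL iF) (nodeOf iU iF)) iF)
    (fanoutFn (xorF ∘ fanoutFn iT (nodeOf iU iF)) iF)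

/-- `factorF ∈ FP`. [folklore] -/
theorem factorF_mem_FP : factorF ∈ FP := by
  obtain ⟨hL, hT, hF, hU⟩ := iAcc_mem_FP
  exact comp_mem_FP fmulOpF_mem_FP (fanoutFn_mem_FP
    (comp_mem_FP finvF_mem_FP (fanoutFn_mem_FP (comp_mem_FP xorF_mem_FP (fanoutFn_mem_FP (nodeOf_mem_FP hL hF) (nodeOf_mem_FP hU hF))) hF))
    (fanoutFn_mem_FP (comp_mem_FP xorF_mem_FP (fanoutFn_mem_FP hT (nodeOf_mem_FP hU hF))) hF))

/-- **Value of the factor brick.** [folklore] -/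
theorem factorF_apply (hM : 1 ≤ M) {l u D : ℕ} (hl : l < 2 ^ (M + 1)) (hu : u < 2 ^ (M + 1)) (t : GF2 M) :
    factorF (boolPair (bCtx l (bits M t) D (modStr M)) (ones u)) =
      bits M ((nodeVal M l - nodeVal M u)⁻¹ * (t - nodeVal M u)) := by
  obtain ⟨h1, h2, h3, h4⟩ := iAcc_apply l (bits M t) D (modStr M) u
  have hnl : nodeOf iL iF (boolPair (bCtx l (bits M t) D (modStr M)) (ones u)) = bits M (nodeVal M l) :=
    nodeOf_apply M h3 (by rw [h1, ones, List.length_replicate]) hl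
  have hnu : nodeOf iU iF (boolPair (bCtx l (bits M t) D (modStr M)) (ones u)) = bits M (nodeVal M u) :=
    nodeOf_apply M h3 (by rw [h4, ones, List.length_replicate]) hu
  have hinv : ∀ x : GF2 M, x ^ (2 ^ (M + 1) - 2) = x⁻¹ := fun x => by
    have hx := finvStr_bits M hM x
    rw [finvStr, fpowStr_bits] at hx
    exact bits_injective M hx
  rw [factorF]
  simp only [Function.comp_apply, fanoutFn_apply, hnl, hnu, h2, h3]
  rw [xorF_apply, xorF_apply, xorStr_bits, xorStr_bits, finvF_bits, fmulOpF_bits, hinv, sub_eq_add', sub_eq_add']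

/-- **The basis piece** on `⟨bCtx, 1ᵘ⟩`: `⟨(u = l ? 1 : factor), f⟩`. [folklore] -/
def basisPieceF : List Bool → List Bool :=
  fanoutFn (iteFn (eqPairFn ∘ fanoutFn iU iL) (oneFrom iF) factorF) iF

/-- `basisPieceF ∈ FP`. [folklore] -/
theorem basisPieceF_mem_FP : basisPieceF ∈ FP := by
  obtain ⟨hL, -, hF, hU⟩ := iAcc_mem_FP
  exact fanoutFn_mem_FP (iteFn_mem_FP (comp_mem_FP eqPairFn_mem_FP (fanoutFn_mem_FP hU hL)) (oneFrom_mem_FP hF) factorF_mem_FP) hF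

/-- **Value of the basis piece.** [folklore] -/
theorem basisPieceF_apply (hM : 1 ≤ M) {l u D : ℕ} (hl : l < 2 ^ (M + 1)) (hu : u < 2 ^ (M + 1)) (t : GF2 M) :
    basisPieceF (boolPair (bCtx l (bits M t) D (modStr M)) (ones u)) = boolPair (bits M (basisFactorVal M l u t)) (modStr M) := by
  obtain ⟨h1, -, h3, h4⟩ := iAcc_apply l (bits M t) D (modStr M) u
  have hc : (eqPairFn ∘ fanoutFn iU iL) (boolPair (bCtx l (bits M t) D (modStr M)) (ones u)) = [decide (u = l)] := by
    simp only [Function.comp_apply, fanoutFn_apply, h1, h4, eqPairFn_boolPair]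
    congr 2
    exact propext ⟨fun h => by simpa [ones] using congrArg List.length h, fun h => by rw [h]⟩
  rw [basisPieceF, fanoutFn_apply, h3, iteFn_apply hc, basisFactorVal]
  by_cases hul : u = l
  · rw [if_pos hul, decide_eq_true hul, if_pos rfl, oneFrom_apply M h3]
  · rw [if_neg hul, decide_eq_false hul, if_neg Bool.false_ne_true, factorF_apply M hM hl hu t]

/-- Length of the basis piece on a genuine context: `3M + 6`. [folklore] -/
theorem length_basisPieceF (hM : 1 ≤ M) {l u D : ℕ} (hl : l < 2 ^ (M + 1)) (hu : u < 2 ^ (M + 1)) (t : GF2 M) :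
    (basisPieceF (boolPair (bCtx l (bits M t) D (modStr M)) (ones u))).length = 3 * M + 6 := by
  rw [basisPieceF_apply M hM hl hu t, length_boolPair, length_bits, (modStr_top M).1]; ring

/-- Initialisation of the basis fold: `⟨bCtx, ⟨encodeNat D, ⟨1⁰, 1⟩⟩⟩`. [folklore] -/
def initB : List Bool → List Bool :=
  fanoutFn (fun w => w) (fanoutFn (lenBinF ∘ fstF ∘ sndF) (fanoutFn (fun _ => []) (oneFrom (sndF ∘ sndF))))

/-- `initB ∈ FP`. [folklore] -/
theorem initB_mem_FP : initB ∈ FP :=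
  fanoutFn_mem_FP (PolyTimeComputable.id _) (fanoutFn_mem_FP (comp_mem_FP lenBinF_mem_FP (comp_mem_FP fstF_mem_FP sndF_mem_FP))
    (fanoutFn_mem_FP (const_mem_FP _) (oneFrom_mem_FP (comp_mem_FP sndF_mem_FP sndF_mem_FP))))

/-- Value of `initB`. [folklore] -/
theorem initB_apply (l : ℕ) (t : List Bool) (D : ℕ) :
    initB (bCtx l t D (modStr M)) = boolPair (bCtx l t D (modStr M)) (boolPair (encodeNat D) (boolPair (ones 0) (bits M 1))) := by
  have hF : (sndF ∘ sndF) (bCtx l t D (modStr M)) = modStr M := by simp [bCtx]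
  simp only [initB, fanoutFn_apply, Function.comp_apply, lenBinF_apply, oneFrom_apply M hF]
  simp [bCtx, ones]

/-- **The basis brick** on `bCtx`: the product fold of the basis pieces. [cite: AroraBarakCC2009, §A.6] -/
def basisF : List Bool → List Bool := sndPow 2 ∘ foldLoop fmulOpF (clipF 3 basisPieceF) X ∘ initB

/-- **`basisF ∈ FP`.** [folklore] -/
theorem basisF_mem_FP : basisF ∈ FP :=
  comp_mem_FP (sndPow_mem_FP 2) (comp_mem_FP
    (foldLoop_clipF_mem_FP 3 fmulOpF_mem_FP length_fmulOpF_le basisPieceF_mem_FP _) initB_mem_FP)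

/-- **Value of the basis brick**: the bits of `∏_{u<D} basisFactor_{l,u}(t)` (`l < D ≤ 2^{M+1}`). [cite: AroraBarakCC2009, §A.6] -/
theorem basisF_apply (hM : 1 ≤ M) {l D : ℕ} (hD : D ≤ 2 ^ (M + 1)) (hl : l < 2 ^ (M + 1)) (t : GF2 M) :
    basisF (bCtx l (bits M t) D (modStr M)) = bits M (∏ u ∈ range D, basisFactorVal M l u t) := by
  set B := bCtx l (bits M t) D (modStr M) with hBdef
  have hk : D ≤ (X : Polynomial ℕ).eval B.length := by
    simp only [eval_X, hBdef, bCtx, length_boolPair, ones, List.length_replicate]; omega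
  have hloop := foldLoop_apply fmulOpF (clipF 3 basisPieceF) hk 0 (bits M 1)
  rw [basisF, Function.comp_apply, Function.comp_apply, initB_apply, hloop, sndPow_succ_boolPair, sndPow_succ_boolPair,
    sndPow_zero_boolPair, foldAcc_clipF (fun u _ hu' => ?_)]
  · rw [foldAcc_eq_foldl fmulOpF basisPieceF B (fun acc p => fmulStr M acc (fstF p))
      (fun u => basisPieceF (boolPair B (ones u))) D 0 _ (fun a u _ hu' => ?_) (fun u _ _ => rfl)]
    · rw [← prodStr_bits M (fun u => basisFactorVal M l u t) D, prodStr, List.range_eq_range', oneStr]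
      refine List.foldl_ext _ _ _ fun acc u hu' => ?_
      have hu'' : u < D := by simpa using hu'
      rw [hBdef, basisPieceF_apply M hM hl (hu''.trans_le hD) t, fstF_boolPair]
    · have hu'' : u < D := by omega
      rw [hBdef, basisPieceF_apply M hM hl (hu''.trans_le hD) t, fmulOpF_apply_mod, fstF_boolPair]
  · have hu'' : u < D := by omega
    rw [hBdef, length_basisPieceF M hM hl (hu''.trans_le hD) t]
    simp only [bCtx, length_boolPair, (modStr_top M).1]; omega

/-! ### The Lagrange brick: `Σ_l y_l · basis_l(t)` on `⟨⟨t, Y⟩, ⟨1ᴰ, f⟩⟩` -/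

/-- The Lagrange context `⟨⟨t, Y⟩, ⟨1ᴰ, f⟩⟩`. [folklore] -/
def lCtx (t Y : List Bool) (D : ℕ) (f : List Bool) : List Bool := boolPair (boolPair t Y) (boolPair (ones D) f)

/-- `t` of the piece argument `⟨lCtx, 1ˡ⟩`. [folklore] -/
def oT : List Bool → List Bool := fstF ∘ fstF ∘ fstF
/-- `Y` of `⟨lCtx, 1ˡ⟩`. [folklore] -/
def oY : List Bool → List Bool := sndF ∘ fstF ∘ fstF
/-- `1ᴰ` of `⟨lCtx, 1ˡ⟩`. [folklore] -/
def oD : List Bool → List Bool := fstF ∘ sndF ∘ fstF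
/-- `f` of `⟨lCtx, 1ˡ⟩`. [folklore] -/
def oF : List Bool → List Bool := sndF ∘ sndF ∘ fstF
/-- `1ˡ` of `⟨lCtx, 1ˡ⟩`. [folklore] -/
def oL : List Bool → List Bool := sndF

/-- The accessors are in `FP`. [folklore] -/
theorem oAcc_mem_FP : oT ∈ FP ∧ oY ∈ FP ∧ oD ∈ FP ∧ oF ∈ FP ∧ oL ∈ FP :=
  ⟨comp_mem_FP fstF_mem_FP (comp_mem_FP fstF_mem_FP fstF_mem_FP),
   comp_mem_FP sndF_mem_FP (comp_mem_FP fstF_mem_FP fstF_mem_FP),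
   comp_mem_FP fstF_mem_FP (comp_mem_FP sndF_mem_FP fstF_mem_FP),
   comp_mem_FP sndF_mem_FP (comp_mem_FP sndF_mem_FP fstF_mem_FP), sndF_mem_FP⟩

/-- Values of the accessors. [folklore] -/
theorem oAcc_apply (t Y : List Bool) (D : ℕ) (f : List Bool) (l : ℕ) :
    oT (boolPair (lCtx t Y D f) (ones l)) = t ∧ oY (boolPair (lCtx t Y D f) (ones l)) = Y ∧
    oD (boolPair (lCtx t Y D f) (ones l)) = ones D ∧ oF (boolPair (lCtx t Y D f) (ones l)) = f ∧
    oL (boolPair (lCtx t Y D f) (ones l)) = ones l := by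
  simp [oT, oY, oD, oF, oL, lCtx]

/-- **The term piece** `y_l · basis_l(t)` on `⟨lCtx, 1ˡ⟩`: the answer block `l` of `Y` (`blockAt`) times
the basis brick on the assembled basis context. [cite: AroraBarakCC2009, §A.6] -/
def termPieceF : List Bool → List Bool :=
  fmulOpF ∘ fanoutFn (blockAt ∘ fanoutFn oY (fanoutFn oL oF))
    (fanoutFn (basisF ∘ fanoutFn (fanoutFn oL oT) (fanoutFn oD oF)) oF)

/-- `termPieceF ∈ FP`. [folklore] -/
theorem termPieceF_mem_FP : termPieceF ∈ FP := by
  obtain ⟨hT, hY, hD, hF, hL⟩ := oAcc_mem_FP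
  exact comp_mem_FP fmulOpF_mem_FP (fanoutFn_mem_FP (comp_mem_FP blockAt_mem_FP (fanoutFn_mem_FP hY (fanoutFn_mem_FP hL hF)))
    (fanoutFn_mem_FP (comp_mem_FP basisF_mem_FP (fanoutFn_mem_FP (fanoutFn_mem_FP hL hT) (fanoutFn_mem_FP hD hF))) hF))

/-- **Value of the term piece** (`l < D ≤ 2^{M+1}`, block `l` of `Y` the bits of `y l`). [folklore] -/
theorem termPieceF_apply (hM : 1 ≤ M) {D : ℕ} (hD : D ≤ 2 ^ (M + 1)) {y : ℕ → GF2 M} {Y : List Bool}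
    (hY : ∀ l < D, HashBricks.blk Y (M + 1) l = bits M (y l)) (t : GF2 M) {l : ℕ} (hl : l < D) :
    termPieceF (boolPair (lCtx (bits M t) Y D (modStr M)) (ones l)) =
      bits M (y l * ∏ u ∈ range D, basisFactorVal M l u t) := by
  obtain ⟨h1, h2, h3, h4, h5⟩ := oAcc_apply (bits M t) Y D (modStr M) l
  have hb : (blockAt ∘ fanoutFn oY (fanoutFn oL oF)) (boolPair (lCtx (bits M t) Y D (modStr M)) (ones l)) = bits M (y l) := by
    simp only [Function.comp_apply, fanoutFn_apply, h2, h5, h4, blockAt_apply, hY l hl]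
  have hc : (basisF ∘ fanoutFn (fanoutFn oL oT) (fanoutFn oD oF)) (boolPair (lCtx (bits M t) Y D (modStr M)) (ones l)) =
      bits M (∏ u ∈ range D, basisFactorVal M l u t) := by
    simp only [Function.comp_apply, fanoutFn_apply, h1, h3, h4, h5]
    exact basisF_apply M hM hD (hl.trans_le hD) t
  rw [termPieceF, Function.comp_apply, fanoutFn_apply, fanoutFn_apply, hb, hc, h4, fmulOpF_bits]

/-- Length of the term piece on a genuine context: `M + 1`. [folklore] -/
theorem length_termPieceF (hM : 1 ≤ M) {D : ℕ} (hD : D ≤ 2 ^ (M + 1)) {y : ℕ → GF2 M} {Y : List Bool}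
    (hY : ∀ l < D, HashBricks.blk Y (M + 1) l = bits M (y l)) (t : GF2 M) {l : ℕ} (hl : l < D) :
    (termPieceF (boolPair (lCtx (bits M t) Y D (modStr M)) (ones l))).length = M + 1 := by
  rw [termPieceF_apply M hM hD hY t hl, length_bits]

/-- The zero string `0^{M+1}` from a modulus accessor. [folklore] -/
def zeroFrom (F : List Bool → List Bool) : List Bool → List Bool :=
  Kannan.zerosFn ∘ dropFn ∘ fanoutFn (fun _ => [true]) F

/-- `zeroFrom F ∈ FP`. [folklore] -/
theorem zeroFrom_mem_FP {F : List Bool → List Bool} (hF : F ∈ FP) : zeroFrom F ∈ FP :=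
  comp_mem_FP Kannan.zerosFn_mem_FP (comp_mem_FP dropFn_mem_FP (fanoutFn_mem_FP (const_mem_FP _) hF))

/-- Value of `zeroFrom`: `bits M 0`. [folklore] -/
theorem zeroFrom_apply {F : List Bool → List Bool} {w : List Bool} (h : F w = modStr M) : zeroFrom F w = bits M 0 := by
  simp only [zeroFrom, Function.comp_apply, fanoutFn_apply, h, dropFn_boolPair, Kannan.zerosFn_apply, List.length_drop,
    (modStr_top M).1, List.length_singleton, bits_zero]
  rw [show M + 1 + 1 - 1 = M + 1 by omega]

/-- Initialisation of the Lagrange fold: `⟨lCtx, ⟨encodeNat D, ⟨1⁰, 0⟩⟩⟩`. [folklore] -/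
def initL : List Bool → List Bool :=
  fanoutFn (fun w => w) (fanoutFn (lenBinF ∘ fstF ∘ sndF) (fanoutFn (fun _ => []) (zeroFrom (sndF ∘ sndF))))

/-- `initL ∈ FP`. [folklore] -/
theorem initL_mem_FP : initL ∈ FP :=
  fanoutFn_mem_FP (PolyTimeComputable.id _) (fanoutFn_mem_FP (comp_mem_FP lenBinF_mem_FP (comp_mem_FP fstF_mem_FP sndF_mem_FP))
    (fanoutFn_mem_FP (const_mem_FP _) (zeroFrom_mem_FP (comp_mem_FP sndF_mem_FP sndF_mem_FP))))

/-- Value of `initL`. [folklore] -/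
theorem initL_apply (t Y : List Bool) (D : ℕ) :
    initL (lCtx t Y D (modStr M)) = boolPair (lCtx t Y D (modStr M)) (boolPair (encodeNat D) (boolPair (ones 0) (bits M 0))) := by
  have hF : (sndF ∘ sndF) (lCtx t Y D (modStr M)) = modStr M := by simp [lCtx]
  simp only [initL, fanoutFn_apply, Function.comp_apply, lenBinF_apply, zeroFrom_apply M hF]
  simp [lCtx, ones]

/-- **The Lagrange brick** on `lCtx`: the xor fold of the term pieces. [cite: AroraBarakCC2009, §A.6] [cite: LundEtAl1992, §3] -/
def lagF : List Bool → List Bool := sndPow 2 ∘ foldLoop xorF (clipF 1 termPieceF) X ∘ initL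

/-- **`lagF ∈ FP`.** [folklore] -/
theorem lagF_mem_FP : lagF ∈ FP :=
  comp_mem_FP (sndPow_mem_FP 2) (comp_mem_FP (foldLoop_clipF_mem_FP 1 xorF_mem_FP length_xorF_le termPieceF_mem_FP _) initL_mem_FP)

/-- **Value of the Lagrange brick**: the bits of `lagVal M D y t` (`D ≤ 2^{M+1}`, the first `D` blocks of
`Y` the bits of the values `y`). [cite: AroraBarakCC2009, §A.6] -/
theorem lagF_apply (hM : 1 ≤ M) {D : ℕ} (hD : D ≤ 2 ^ (M + 1)) {y : ℕ → GF2 M} {Y : List Bool}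
    (hY : ∀ l < D, HashBricks.blk Y (M + 1) l = bits M (y l)) (t : GF2 M) :
    lagF (lCtx (bits M t) Y D (modStr M)) = bits M (lagVal M D y t) := by
  set L := lCtx (bits M t) Y D (modStr M) with hLdef
  have hk : D ≤ (X : Polynomial ℕ).eval L.length := by
    simp only [eval_X, hLdef, lCtx, length_boolPair, ones, List.length_replicate]; omega
  have hloop := foldLoop_apply xorF (clipF 1 termPieceF) hk 0 (bits M 0)
  rw [lagF, Function.comp_apply, Function.comp_apply, initL_apply, hloop, sndPow_succ_boolPair, sndPow_succ_boolPair,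
    sndPow_zero_boolPair, foldAcc_clipF (fun l _ hl' => ?_)]
  · rw [foldAcc_eq_foldl xorF termPieceF L (fun acc p => xorStr acc p) (fun l => termPieceF (boolPair L (ones l))) D 0 _
      (fun a l _ _ => xorF_apply _ _) (fun l _ _ => rfl)]
    rw [lagVal, ← sumStr_bits M (fun l => y l * ∏ u ∈ range D, basisFactorVal M l u t) D, sumStr, List.range_eq_range']
    refine List.foldl_ext _ _ _ fun acc l hl' => ?_
    have hl'' : l < D := by simpa using hl'
    rw [hLdef, termPieceF_apply M hM hD hY t hl'']
  · have hl'' : l < D := by omega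
    rw [hLdef, length_termPieceF M hM hD hY t hl'']
    simp only [lCtx, length_boolPair, (modStr_top M).1]; omega

end TVChk

end Literature.Computability.Complexity

end
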